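import Literature.Probability.RandomPlanarGeometry.LoewnerSwallowedInterval
import Literature.Probability.RandomPlanarGeometry.LoewnerHullConnected
import Literature.Probability.RandomPlanarGeometry.StarHullClusters
import Literature.Probability.RandomPlanarGeometry.StarHullClopenPiece
import HarnessLib

/-!
# The Loewner hull swallows cluster neighbourhoods whole

Topic `Probability/RandomPlanarGeometry`; theorems only. For a chordal Loewner chain generated by a
curve `γ` (continuous driving function from `0`) and a set `C` in the closed half-plane which misses
`γ[0, t]` and `0`, reaches up at its real points and has connected nonempty part in `ℍ`, the closed
hull `K̂_t = Loewner.closedHull W t` either contains `C` or misses it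
(`IsGeneratedByCurve.subset_closedHull_or_disjoint`): the part of `C` in `ℍ` lies in one component
of `ℍ ∖ γ[0,t]`, bounded or not (`IsGeneratedByCurve.mem_hull_iff`), and a real point of `C` is
swallowed iff the curve has met the real ray beyond it (`swallowingTime_ofReal_eq_firstHit_of_ne`),
iff the points of `ℍ` just above it are enclosed (`JordanCurveTheorem.exists_isBounded_connectedComponentIn`,
resp. a thin half-strip along the ray joining them to `∞`).

Applied to the `δ`-cluster neighbourhoods of a `*`-hull `A` (`StarHullClusters`): while the curve
stays `δ`-far from `A`, the swallowed part `A ∩ K̂_t` is a union of `δ`-clusters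
(`deltaCluster_subset_closedHull`), so the remaining part `A ∖ K̂_t` is a clopen piece of `A`, a
`*`-hull (`isStarHull_diff_closedHull`, via `IsStarHull.isStarHull_piece`). This is the hull-side
input for following the conformal image of SLE₆ through the (finitely many) swallowing instants in
the proof of locality (Lawler–Schramm–Werner (2001) Thm. 2.2; Lawler (2005) §6.3 Thm. 6.13).

## References

* G. F. Lawler, *Conformally Invariant Processes in the Plane* (2005), §6.3 Thm. 6.13, Rem. 6.6. [Lawler2005]
* S. Rohde, O. Schramm, Ann. of Math. 161 (2005), Lemma 7.3 (sealed intervals). [RohdeSchramm2005]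
-/

noncomputable section

open Set Filter Topology Metric Bornology Complex
open UpperHalfPlane (upperHalfPlaneSet isOpen_upperHalfPlaneSet)
open scoped NNReal

namespace Literature.Probability.RandomPlanarGeometry

namespace Loewner

variable {W : ℝ≥0 → ℝ} {γ : ℝ≥0 → ℂ}

/-! ### A thin half-strip along a real ray -/

/-- The open half-strip of height `η` along the real ray from `x ≠ 0` away from `0`. [folklore] -/
def rayStrip (x η : ℝ) : Set ℂ :=
  {w : ℂ | 0 < w.im ∧ w.im < η ∧ (0 < x → x ≤ w.re) ∧ (x < 0 → w.re ≤ x)}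

/-- The half-strip is convex. [folklore] -/
theorem convex_rayStrip (x η : ℝ) : Convex ℝ (rayStrip x η) := by
  have h1 : Convex ℝ {w : ℂ | 0 < w.im} := convex_halfSpace_im_gt 0
  have h2 : Convex ℝ {w : ℂ | w.im < η} := convex_halfSpace_im_lt η
  have h3 : Convex ℝ {w : ℂ | 0 < x → x ≤ w.re} := by
    by_cases hx : 0 < x
    · simpa [hx] using convex_halfSpace_re_ge x
    · simpa [hx] using convex_univ
  have h4 : Convex ℝ {w : ℂ | x < 0 → w.re ≤ x} := by
    by_cases hx : x < 0
    · simpa [hx] using convex_halfSpace_re_le x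
    · simpa [hx] using convex_univ
  have : rayStrip x η = {w : ℂ | 0 < w.im} ∩ {w : ℂ | w.im < η} ∩ {w : ℂ | 0 < x → x ≤ w.re} ∩
      {w : ℂ | x < 0 → w.re ≤ x} := by
    ext w; simp only [rayStrip, mem_setOf_eq, mem_inter_iff]; tauto
  rw [this]
  exact ((h1.inter h2).inter h3).inter h4

/-- Points of the half-strip are within `η` of the ray (their foot `Re w` is on the ray). [folklore] -/
theorem infDist_realRay_lt_of_mem_rayStrip {x η : ℝ} {w : ℂ} (hw : w ∈ rayStrip x η) :
    infDist w (realRay x) < η := by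
  obtain ⟨h0, hη, hpos, hneg⟩ := hw
  have hfoot : ((w.re : ℝ) : ℂ) ∈ realRay x := by
    rw [mem_realRay_iff]; exact ⟨by simp, fun h ↦ by simpa using hpos h, fun h ↦ by simpa using hneg h⟩
  refine (infDist_le_dist_of_mem hfoot).trans_lt ?_
  rw [dist_eq_norm, show w - ((w.re : ℝ) : ℂ) = ((w.im : ℝ) : ℂ) * I from
    Complex.ext (by simp) (by simp), norm_mul, norm_real, norm_I, mul_one, Real.norm_of_nonneg h0.le]
  exact hη

/-- The half-strip is unbounded. [folklore] -/
theorem not_isBounded_rayStrip {x η : ℝ} (hx : x ≠ 0) (hη : 0 < η) : ¬ IsBounded (rayStrip x η) := by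
  intro hb
  obtain ⟨R, hR⟩ := hb.subset_closedBall 0
  -- the far point `x ± (|R| + |x| + 1) + i η/2`
  set s : ℝ := if 0 < x then |R| + |x| + 1 else -(|R| + |x| + 1) with hs
  set w : ℂ := ⟨x + s, η / 2⟩ with hw
  have hwmem : w ∈ rayStrip x η := by
    refine ⟨by simp [hw]; positivity, by simp [hw]; linarith, fun h ↦ ?_, fun h ↦ ?_⟩
    · simp only [hw, hs, if_pos h]; linarith [abs_nonneg R, abs_nonneg x]
    · simp only [hw, hs, if_neg (not_lt.2 h.le)]; linarith [abs_nonneg R, abs_nonneg x]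
  have h1 := hR hwmem
  rw [mem_closedBall, dist_zero_right] at h1
  have h2 : |w.re| ≤ ‖w‖ := abs_re_le_norm w
  have h3 : w.re = x + s := rfl
  rcases lt_or_gt_of_ne hx with hneg | hpos
  · rw [hs, if_neg (not_lt.2 hneg.le)] at h3
    have : |w.re| ≥ |R| + 1 := by
      rw [h3, abs_of_neg (by linarith [abs_nonneg R, abs_nonneg x])]
      linarith [neg_abs_le x]
    linarith [le_abs_self R]
  · rw [hs, if_pos hpos] at h3
    have : |w.re| ≥ |R| + 1 := by
      rw [h3, abs_of_pos (by linarith [abs_nonneg R, abs_nonneg x])]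
      linarith [le_abs_self x]
    linarith [le_abs_self R]

/-- `x + iε` lies in the half-strip for `0 < ε < η`. [folklore] -/
theorem ofReal_add_mul_I_mem_rayStrip {x η ε : ℝ} (hε : 0 < ε) (hεη : ε < η) :
    (x : ℂ) + ε * I ∈ rayStrip x η :=
  ⟨by simp [hε], by simp [hεη], fun _ ↦ by simp, fun _ ↦ by simp⟩

/-! ### The dichotomy -/

section Dichotomy

variable (hγ : IsGeneratedByCurve W γ) (hW : Continuous W) (hW0 : W 0 = 0)
include hγ hW hW0

/-- **A set reaching up at its real points, with connected nonempty part in `ℍ`, missing the curve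
and `0`, is swallowed whole or not at all.** See the module docstring.
[cite: Lawler2005, Rem. 6.6; RohdeSchramm2005, Lemma 7.3] -/
theorem IsGeneratedByCurve.subset_closedHull_or_disjoint {t : ℝ≥0} {C : Set ℂ}
    (hCim : ∀ z ∈ C, 0 ≤ z.im) (hC0 : (0 : ℂ) ∉ C) (hCγ : Disjoint C (γ '' Icc 0 t))
    (hCconn : IsPreconnected (C ∩ upperHalfPlaneSet)) (hCne : (C ∩ upperHalfPlaneSet).Nonempty)
    (hCup : ∀ x : ℝ, (x : ℂ) ∈ C → ∀ᶠ ε : ℝ in 𝓝[>] 0, (x : ℂ) + ε * I ∈ C) :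
    C ⊆ closedHull W t ∨ Disjoint C (closedHull W t) := by
  set Γ : Set ℂ := γ '' Icc 0 t with hΓ
  have hΓc : IsCompact Γ := isCompact_Icc.image hγ.continuous
  set U : Set ℂ := upperHalfPlaneSet \ Γ with hU
  have hUo : IsOpen U := isOpen_upperHalfPlaneSet.sdiff hΓc.isClosed
  have hγ0 : γ 0 = 0 := by rw [hγ.apply_zero, hW0]; simp
  have h0Γ : (0 : ℂ) ∈ Γ := ⟨0, ⟨le_rfl, zero_le⟩, hγ0⟩
  obtain ⟨z₀, hz₀C, hz₀H⟩ := hCne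
  set V := connectedComponentIn U z₀ with hV
  have hCU : C ∩ upperHalfPlaneSet ⊆ U := fun z hz ↦ ⟨hz.2, fun hzΓ ↦ Set.disjoint_left.1 hCγ hz.1 hzΓ⟩
  have hCV : C ∩ upperHalfPlaneSet ⊆ V := hCconn.subset_connectedComponentIn ⟨hz₀C, hz₀H⟩ hCU
  have hcomp : ∀ z ∈ C ∩ upperHalfPlaneSet, connectedComponentIn U z = V := fun z hz ↦
    (connectedComponentIn_eq (hCV hz)).symm
  -- real points of `C` are nonzero and off the curve
  have hreal : ∀ z ∈ C, z.im = 0 → z = ((z.re : ℝ) : ℂ) ∧ z.re ≠ 0 := fun z hz hzim ↦ by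
    have h1 : z = ((z.re : ℝ) : ℂ) := Complex.ext (by simp) (by simp [hzim])
    refine ⟨h1, fun h0 ↦ hC0 ?_⟩
    have : z = 0 := Complex.ext (by simp [h0]) (by simp [hzim])
    rwa [this] at hz
  by_cases hb : IsBounded V
  · -- every point of `C` is swallowed
    left
    intro z hzC
    rcases (hCim z hzC).lt_or_eq with hzH | hzim
    · have hzU : z ∈ U := hCU ⟨hzC, hzH⟩
      have hzhull : z ∈ hull W t := (hγ.mem_hull_iff hzH hzU.2).2 (by rw [hcomp z ⟨hzC, hzH⟩]; exact hb)
      exact hull_subset_closedHull W t hzhull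
    · obtain ⟨hzeq, hx0⟩ := hreal z hzC hzim.symm
      set x : ℝ := z.re with hxdef
      rw [hzeq]
      refine mem_closedHull_iff.2 (Or.inr ⟨by simp, ?_⟩)
      by_contra hTx
      rw [not_le] at hTx
      -- the curve misses the ray from `x` on `[0, t]`
      have hmiss : ∀ p ∈ Γ, p ∉ realRay x := by
        rintro _ ⟨s, hs, rfl⟩
        exact hγ.apply_notMem_realRay_of_lt_swallowingTime hW hW0 hx0
          (lt_of_le_of_lt (WithTop.coe_le_coe.2 hs.2) hTx)
      -- positive distance from the compact `Γ` to the closed ray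
      obtain ⟨η, hη, hηdist⟩ : ∃ η > 0, ∀ p ∈ Γ, η ≤ infDist p (realRay x) := by
        have hcont : ContinuousOn (fun p ↦ infDist p (realRay x)) Γ :=
          (continuous_infDist_pt _).continuousOn
        obtain ⟨p₀, hp₀, hmin⟩ := hΓc.exists_isMinOn ⟨0, h0Γ⟩ hcont
        refine ⟨infDist p₀ (realRay x), ?_, fun p hp ↦ hmin hp⟩
        have hne : (realRay x).Nonempty := ⟨x, ofReal_mem_realRay x⟩
        exact ((isClosed_realRay x).notMem_iff_infDist_pos hne).1 (hmiss p₀ hp₀)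
      -- the half-strip joins `x + iε` to `∞` off the curve
      have hSU : rayStrip x η ⊆ U := fun w hw ↦
        ⟨hw.1, fun hwΓ ↦ (infDist_realRay_lt_of_mem_rayStrip hw).not_ge (hηdist w hwΓ)⟩
      have hxC : (x : ℂ) ∈ C := hzeq ▸ hzC
      obtain ⟨ε, hεC, hε0, hεη⟩ : ∃ ε : ℝ, (x : ℂ) + ε * I ∈ C ∧ 0 < ε ∧ ε < η := by
        obtain ⟨ε, hε⟩ := ((hCup x hxC).and (Ioo_mem_nhdsGT hη : ∀ᶠ ε in 𝓝[>] (0 : ℝ), ε ∈ Ioo 0 η)).exists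
        exact ⟨ε, hε.1, hε.2.1, hε.2.2⟩
      set w : ℂ := (x : ℂ) + ε * I with hw
      have hwH : w ∈ upperHalfPlaneSet := by show 0 < w.im; simp [hw, hε0]
      have hwS : w ∈ rayStrip x η := ofReal_add_mul_I_mem_rayStrip hε0 hεη
      have hSV : rayStrip x η ⊆ V := by
        rw [← hcomp w ⟨hεC, hwH⟩]
        exact (convex_rayStrip x η).isPreconnected.subset_connectedComponentIn hwS hSU
      exact not_isBounded_rayStrip hx0 hη (hb.subset hSV)
  · -- no point of `C` is swallowed
    right
    refine Set.disjoint_left.2 fun z hzC hzK ↦ ?_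
    rcases (hCim z hzC).lt_or_eq with hzH | hzim
    · have hzU : z ∈ U := hCU ⟨hzC, hzH⟩
      rcases mem_closedHull_iff.1 hzK with hzh | ⟨hzim, -⟩
      · exact hb (by rw [← hcomp z ⟨hzC, hzH⟩]; exact (hγ.mem_hull_iff hzH hzU.2).1 hzh)
      · exact absurd hzim (ne_of_gt hzH)
    · obtain ⟨hzeq, hx0⟩ := hreal z hzC hzim.symm
      set x : ℝ := z.re with hxdef
      have hxC : (x : ℂ) ∈ C := hzeq ▸ hzC
      have hTx : swallowingTime W x ≤ t := by
        rcases mem_closedHull_iff.1 hzK with hzh | ⟨-, hT⟩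
        · have hpos : (0 : ℝ) < z.im := hull_subset W t hzh
          rw [← hzim] at hpos
          exact absurd hpos (lt_irrefl _)
        · rwa [hzeq] at hT
      -- the swallowing time `s ≤ t` of `x` and the curve point `γ s` on the ray beyond `x`
      obtain ⟨s, hs⟩ := WithTop.ne_top_iff_exists.1 (ne_top_of_le_ne_top WithTop.coe_ne_top hTx)
      have hst : s ≤ t := by rw [← hs] at hTx; exact WithTop.coe_le_coe.1 hTx
      have hγs : γ s ∈ realRay x := hγ.apply_mem_realRay_of_swallowingTime_eq hW hW0 hx0 hs.symm
      have hγsΓ : γ s ∈ Γ := ⟨s, ⟨zero_le, hst⟩, rfl⟩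
      have hγsx : γ s ≠ x := fun h ↦ Set.disjoint_left.1 hCγ hxC (h ▸ hγsΓ)
      obtain ⟨hγsim, hγspos, hγsneg⟩ := (mem_realRay_iff).1 hγs
      have hγseq : γ s = (((γ s).re : ℝ) : ℂ) := Complex.ext (by simp) (by simp [hγsim])
      have hre_ne : (γ s).re ≠ x := fun h ↦ hγsx (by rw [hγseq, h])
      -- the continuum `γ[0, s]`
      set C' : Set ℂ := γ '' Icc 0 s with hC'
      have hC'Γ : C' ⊆ Γ := image_mono (Icc_subset_Icc_right hst)
      have hC'c : IsCompact C' := isCompact_Icc.image hγ.continuous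
      have hC'conn : IsPreconnected C' := isPreconnected_Icc.image _ hγ.continuous.continuousOn
      have hC'im : ∀ w ∈ C', 0 ≤ w.im := by rintro _ ⟨v, -, rfl⟩; exact hγ.im_nonneg v
      have hxC' : (x : ℂ) ∉ C' := fun h ↦ Set.disjoint_left.1 hCγ hxC (hC'Γ h)
      have h0C' : (((0 : ℝ) : ℝ) : ℂ) ∈ C' := ⟨0, ⟨le_rfl, zero_le⟩, by simp [hγ0]⟩
      have hbC' : ((((γ s).re : ℝ)) : ℂ) ∈ C' := hγseq ▸ ⟨s, ⟨zero_le, le_rfl⟩, rfl⟩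
      -- enclosure near `x`
      obtain ⟨r, hr, henc⟩ : ∃ r > 0, ∀ w ∈ ball (x : ℂ) r, 0 < w.im →
          IsBounded (connectedComponentIn (upperHalfPlaneSet \ C') w) := by
        rcases lt_or_gt_of_ne hx0 with hneg | hpos
        · have hlt : (γ s).re < x := lt_of_le_of_ne (hγsneg hneg) hre_ne
          exact Literature.Topology.PlaneTopology.JordanCurveTheorem_holds.exists_isBounded_connectedComponentIn
            hC'c hC'conn hC'im hlt hneg hbC' h0C' hxC'
        · have hlt : x < (γ s).re := lt_of_le_of_ne (hγspos hpos) (Ne.symm hre_ne)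
          exact Literature.Topology.PlaneTopology.JordanCurveTheorem_holds.exists_isBounded_connectedComponentIn
            hC'c hC'conn hC'im hpos hlt h0C' hbC' hxC'
      -- a point of `C` just above `x` is enclosed, hence swallowed by time `s ≤ t`
      obtain ⟨ε, hεC, hε0, hεr⟩ : ∃ ε : ℝ, (x : ℂ) + ε * I ∈ C ∧ 0 < ε ∧ ε < r := by
        obtain ⟨ε, hε⟩ := ((hCup x hxC).and (Ioo_mem_nhdsGT hr : ∀ᶠ ε in 𝓝[>] (0 : ℝ), ε ∈ Ioo 0 r)).exists
        exact ⟨ε, hε.1, hε.2.1, hε.2.2⟩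
      set w : ℂ := (x : ℂ) + ε * I with hw
      have hwH : w ∈ upperHalfPlaneSet := by show 0 < w.im; simp [hw, hε0]
      have hwball : w ∈ ball (x : ℂ) r := by
        rw [mem_ball, dist_eq_norm, hw, add_sub_cancel_left, norm_mul, norm_real, norm_I, mul_one,
          Real.norm_of_nonneg hε0.le]
        exact hεr
      have hwU : w ∈ U := hCU ⟨hεC, hwH⟩
      have hwC' : w ∉ C' := fun h ↦ hwU.2 (hC'Γ h)
      have hws : w ∈ hull W s := (hγ.mem_hull_iff hwH hwC').2 (henc w hwball hwH)
      have hwt : w ∈ hull W t := hull_mono W hst hws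
      exact hb (by rw [← hcomp w ⟨hεC, hwH⟩]; exact (hγ.mem_hull_iff hwH hwU.2).1 hwt)

end Dichotomy

/-! ### Application to the `δ`-clusters of a `*`-hull -/

section Clusters

variable {A : Set ℂ} {δ : ℝ} (hγ : IsGeneratedByCurve W γ) (hW : Continuous W) (hW0 : W 0 = 0)
  (hA : IsStarHull A) (hδ : 0 < δ) (h0 : δ ≤ infDist (0 : ℂ) A)
include hγ hW hW0 hA hδ h0

/-- **A cluster neighbourhood missed by the curve is swallowed whole or not at all.** [cite: Lawler2005, §6.3] -/
theorem IsGeneratedByCurve.deltaClusterNhd_subset_closedHull_or_disjoint {a : ℂ} (ha : a ∈ A) {t : ℝ≥0}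
    (hdisj : Disjoint (deltaClusterNhd A δ a) (γ '' Icc 0 t)) :
    deltaClusterNhd A δ a ⊆ closedHull W t ∨ Disjoint (deltaClusterNhd A δ a) (closedHull W t) := by
  have him : ∀ z ∈ A, 0 ≤ z.im := fun z hz ↦ hA.isBoundedHull.im_nonneg hz
  refine hγ.subset_closedHull_or_disjoint hW hW0 (fun z hz ↦ hz.1) (zero_notMem_deltaClusterNhd ha h0) hdisj
    (isPreconnected_deltaClusterNhd_inter him) (deltaClusterNhd_inter_nonempty him ha hδ) fun x hx ↦ ?_
  obtain ⟨-, c, hc, hxc⟩ := hx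
  have hgap : 0 < δ - dist (x : ℂ) c := sub_pos.2 hxc
  filter_upwards [Ioo_mem_nhdsGT hgap] with ε hε
  refine ⟨by simp [hε.1.le], c, hc, ?_⟩
  calc dist ((x : ℂ) + ε * I) c ≤ dist ((x : ℂ) + ε * I) x + dist (x : ℂ) c := dist_triangle _ _ _
    _ = ε + dist (x : ℂ) c := by
        rw [dist_eq_norm, add_sub_cancel_left, norm_mul, norm_real, norm_I, mul_one, Real.norm_of_nonneg hε.1.le]
    _ < δ := by linarith [hε.2]

/-- **While the curve is `δ`-far from `A`, the swallowed part of `A` is a union of `δ`-clusters.**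
[cite: Lawler2005, §6.3 Thm. 6.13] -/
theorem IsGeneratedByCurve.deltaCluster_subset_closedHull {t : ℝ≥0} (hfar : ∀ s ≤ t, δ ≤ infDist (γ s) A)
    {a : ℂ} (ha : a ∈ A) (hat : a ∈ closedHull W t) : deltaCluster A δ a ⊆ closedHull W t := by
  have him : ∀ z ∈ A, 0 ≤ z.im := fun z hz ↦ hA.isBoundedHull.im_nonneg hz
  have hdisj : Disjoint (deltaClusterNhd A δ a) (γ '' Icc 0 t) := by
    refine Set.disjoint_left.2 ?_
    rintro z hz ⟨s, hs, rfl⟩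
    exact (infDist_lt_of_mem_deltaClusterNhd ha hz).not_ge (hfar s hs.2)
  rcases hγ.deltaClusterNhd_subset_closedHull_or_disjoint hW hW0 hA hδ h0 ha hdisj with h | h
  · exact (deltaCluster_subset_deltaClusterNhd him ha hδ).trans h
  · exact absurd hat (Set.disjoint_left.1 h (deltaCluster_subset_deltaClusterNhd him ha hδ (mem_deltaCluster_self A δ a)))

/-- **While the curve is `δ`-far from `A`, the remaining part `A ∖ K̂_t` is closed** (a finite union of
clusters). [cite: Lawler2005, §6.3 Thm. 6.13] -/
theorem IsGeneratedByCurve.isClosed_diff_closedHull {t : ℝ≥0} (hfar : ∀ s ≤ t, δ ≤ infDist (γ s) A) :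
    IsClosed (A \ closedHull W t) := by
  have hAc : IsClosed A := hA.isBoundedHull.isClosed
  set 𝒞 : Set (Set ℂ) := {C : Set ℂ | ∃ a ∈ A \ closedHull W t, C = deltaCluster A δ a} with h𝒞
  have hfin : 𝒞.Finite :=
    (finite_setOf_deltaCluster hA.isBoundedHull.isCompact hδ).subset fun C ⟨a, ha, hC⟩ ↦ ⟨a, ha.1, hC⟩
  have hsub : ∀ a ∈ A \ closedHull W t, deltaCluster A δ a ⊆ A \ closedHull W t := by
    intro a ha c hc
    refine ⟨deltaCluster_subset ha.1 hc, fun hcK ↦ ha.2 ?_⟩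
    have hca : deltaCluster A δ c = deltaCluster A δ a := deltaCluster_eq_of_mem hc
    have := hγ.deltaCluster_subset_closedHull hW hW0 hA hδ h0 hfar (deltaCluster_subset ha.1 hc) hcK
    rw [hca] at this
    exact this (mem_deltaCluster_self A δ a)
  have heq : A \ closedHull W t = ⋃ C ∈ 𝒞, C := by
    refine Subset.antisymm (fun a ha ↦ mem_iUnion₂.2 ⟨deltaCluster A δ a, ⟨a, ha, rfl⟩, mem_deltaCluster_self A δ a⟩) ?_
    refine iUnion₂_subset ?_
    rintro C ⟨a, ha, rfl⟩
    exact hsub a ha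
  rw [heq]
  refine hfin.isClosed_biUnion ?_
  rintro C ⟨a, ha, rfl⟩
  exact isClosed_deltaCluster hAc hδ ha.1

omit hγ hW0 hδ h0 in
/-- **The swallowed part `A ∩ K̂_t` is closed** (always: the closed hull is compact). [folklore] -/
theorem isClosed_inter_closedHull (t : ℝ≥0) : IsClosed (A ∩ closedHull W t) :=
  hA.isBoundedHull.isClosed.inter (isCompact_closedHull hW t).isClosed

/-- **While the curve is `δ`-far from `A`, the remaining part `A ∖ K̂_t` is a `*`-hull** (possibly empty):
a clopen piece of `A` (`IsStarHull.isStarHull_piece`). [cite: Lawler2005, §6.3 Thm. 6.13] -/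
theorem IsGeneratedByCurve.isStarHull_diff_closedHull {t : ℝ≥0} (hfar : ∀ s ≤ t, δ ≤ infDist (γ s) A) :
    IsStarHull (A \ closedHull W t) := by
  refine hA.isStarHull_piece sdiff_subset (hγ.isClosed_diff_closedHull hW hW0 hA hδ h0 hfar) ?_
  rw [Set.sdiff_sdiff_right_self]
  exact isClosed_inter_closedHull hW hA t

end Clusters

end Loewner

end Literature.Probability.RandomPlanarGeometry

end
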